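import Summits.QuantumAdvantage.QuantumAdvantage.Theorems.CubicForrelationNearExactIsExactTwelveLevelFiveGenericDead

/-!
# Crux `CubicForrelation.NearExactIsExact` (stmt-QuantumAdvantage-14043) — n = 12, open window `(57/64, 29/32)`, a LEVEL-5 side in the RIGID
  case with `4 ∣ e₅` off the odd hyperplane: PFAFFIAN PARITY of the 4-flat sections of `L₅`, a frame with `Pf = 1` EXISTS, `128 ≤ #L₅ ≤ 191`

Certificate seat `b2b-cforr-cert` (gen 29).  HONEST FRAMING: kernel-checked finite-slice lemmas (standard axioms, no `decide` on large goals) about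
cubic Boolean pairs on 12 bits — structure of the second NON-generic level-5 configuration left on the open window by gen 27
(`tzl5_window_structure`): the RIGID case `L₅ := {x ∈ P : e₅ ≢ σ₅ (mod 8)} ≠ ∅`, here under `4 ∣ e₅` off `P` (i.e. not in case α, whose structure
is …TwelveLevelFiveAlphaFlat).  It is the window analogue of gens 22–23's configuration R1 at `Φ = 29/32` (…R1TransversalAt2932), WITHOUT the
hypotheses "`e₅ = 0` off `P`", "`e₅ ∈ {σ, −3σ}`", "`#T = 128`" and without an explicit quadratic `D` (the sign bit `hb = [e₅ ≡ 3 (4)]` only has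
base-free second differences along `V`, `tzl5_hsd`).  NO value of `θ₁₂` is claimed; nothing is excluded except the sub-case "no Pfaffian frame";
NOT summit progress.  Plan: HOME/b2b-cforr-cert-g27/PLAN-N12-WINDOW-O5.md §A (rigid), §C.

Setting.  Cubic `f, g` on 12 bits, `W_g = 32u'`, `P = {u' odd} = x₀ ⊕ V` (`#V = 2048`), `e₅ = u' − 2(−1)^f`, `hb = [e₅ ≡ 3 (mod 4)]`,
`σ₅ = sZ ∘ hb` (so `4 ∣ e₅ − σ₅` on `P`, `tzl5_mod4`), `4 ∣ e₅` off `P`, off-hyperplane energy `≤ 2047`; `B(p,q) = hb(x₀) ⊕ hb(x₀⊕p) ⊕ hb(x₀⊕q)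
⊕ hb(x₀⊕p⊕q)` the (base-free) alternating form and `Pf(a₀,…,a₃)` its Pfaffian.
* `tzr_parity`: for `x ∈ P`, `a₀,…,a₃ ∈ V`: `#{ε ∈ 𝔽₂⁴ : x ⊕ ε·a ∈ L₅}` is even iff `Pf(a) = 0`  [`8 ∣ Σ_{4-flat} e₅` (`tzl5_H4`), `e₅ = σ₅ + 4k`
  pointwise, `Σ σ₅ ≡ 4·Pf (mod 8)` (`ws_sum4_mod8` with `tzl5_hsd`) ⇒ `Σ k ≡ Pf (mod 2)`].
* `tzr_cost`: a point of `L₅` has `e₅² ≥ 9` (cost `e₅² − 1 ≥ 8`).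
* `tzr_noframe_false` / `tzr_frame`: if `L₅ ≠ ∅` and `Σ_P (e₅² − 1) ≤ 1535` (the window budget) then some `a₀,…,a₃ ∈ V` have `Pf(a) = 1`
  [otherwise `L₅` has even parametrised 4-flat sections in `P`, so `#L₅ ≥ 2^{11−3} = 256` by `erm_weight_ge`, costing `≥ 2048`].
* `tzr_sections_odd` / `tzr_L5_card_ge`: for a frame with `Pf = 1` every section count `N(x;a)` (`x ∈ P`) is odd, and `16·#L₅ = Σ_{x∈P} N(x;a)
  ≥ #P = 2048`, so `#L₅ ≥ 128`.
* `tzr_window_rigid`: packaging on the window `57/64 < Φ` with `4 ∣ e₅` off `P` and `L₅ ≠ ∅`: a Pfaffian frame exists, `128 ≤ #L₅ ≤ 191`,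
  `Σ_P (e₅² − 1) ≥ 1024`, off-hyperplane energy `≤ 511`, total slack `≤ 1535`.

References: J. Ax (1964) / R. J. McEliece (1972); MacWilliams–Sloane (1977) Ch. 13 §3, Ch. 15 §2 (symplectic forms, Pfaffians); C. Carlet (2021)
§5.2.  Axioms: the standard three.
-/

set_option linter.dupNamespace false -- D-0017: single-problem summit ⇒ `QuantumAdvantage.QuantumAdvantage` by design

noncomputable section

namespace Summit.QuantumAdvantage.QuantumAdvantage.Theorems.CubicForrelation.NearExactIsExact

open Finset
open Literature.Computability.QuantumComplexity
open Literature.Computability.QuantumComplexity.BuzetChailloux (bxor zeroVec bxor_bxor_cancel_left bxor_zeroVec zeroVec_bxor bxor_comm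
  bxor_self)
open Literature.Computability.QuantumComplexity.DerivativeWalsh (W)

/-! ### Pfaffian parity of the 4-flat sections of `L₅` -/

/-- **Pfaffian parity.**  Rigid-case bookkeeping on the odd hyperplane with `4 ∣ e₅` off it and off-hyperplane energy `≤ 2047`: for `x ∈ P` and
`a₀,…,a₃ ∈ V`, the number of parameters `ε ∈ 𝔽₂⁴` with `x ⊕ ε·a ∈ L₅ = {e₅ ≢ σ₅ (mod 8)}` is even iff the Pfaffian of the alternating form of
the sign bit `hb` on `a₀,…,a₃` vanishes. [this work] -/
theorem tzr_parity (f g : (Fin (6 + 6) → Bool) → Bool) (hf : IsDegLeFun 3 f) (hg : IsDegLeFun 3 g)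
    (u' : (Fin (6 + 6) → Bool) → ℤ) (hu' : ∀ x, W (fun y => signOf (g y)) x = (2 : ℝ) ^ 5 * (u' x : ℝ))
    (V : Finset (Fin (6 + 6) → Bool)) (x₀ : Fin (6 + 6) → Bool) (h0 : zeroVec ∈ V) (hadd : ∀ a ∈ V, ∀ b ∈ V, bxor a b ∈ V)
    (hcardV : #V = 2048) (hP : (univ.filter fun x : Fin (6 + 6) → Bool => Odd (u' x)) = V.image (bxor x₀))
    (h4off : ∀ y, ¬ Odd (u' y) → (4 : ℤ) ∣ u' y - 2 * sZ (f y))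
    (hoff : ∑ y ∈ univ.filter (fun y : Fin (6 + 6) → Bool => ¬ Odd (u' y)), (u' y - 2 * sZ (f y)) ^ 2 ≤ 2047)
    (hb : (Fin (6 + 6) → Bool) → Bool) (hhb : ∀ z, hb z = decide ((u' z - 2 * sZ (f z)) % 4 = 3))
    {x a₀ a₁ a₂ a₃ : Fin (6 + 6) → Bool} (hx : Odd (u' x)) (ha₀ : a₀ ∈ V) (ha₁ : a₁ ∈ V) (ha₂ : a₂ ∈ V) (ha₃ : a₃ ∈ V) :
    Even #(univ.filter fun ε : Fin 4 → Bool =>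
      ¬ (8 : ℤ) ∣ u' (fun j => x j ^^ decide (Odd #(univ.filter fun i => ε i && (![a₀, a₁, a₂, a₃] : Fin 4 → Fin (6 + 6) → Bool) i j))) - 2 * sZ (f (fun j => x j ^^ decide (Odd #(univ.filter fun i => ε i && (![a₀, a₁, a₂, a₃] : Fin 4 → Fin (6 + 6) → Bool) i j)))) - sZ (hb (fun j => x j ^^ decide (Odd #(univ.filter fun i => ε i && (![a₀, a₁, a₂, a₃] : Fin 4 → Fin (6 + 6) → Bool) i j))))) ↔
      ((((hb x₀ ^^ hb (bxor x₀ a₁) ^^ hb (bxor x₀ a₀) ^^ hb (bxor (bxor x₀ a₁) a₀)) && (hb x₀ ^^ hb (bxor x₀ a₃) ^^ hb (bxor x₀ a₂) ^^ hb (bxor (bxor x₀ a₃) a₂))) ^^ ((hb x₀ ^^ hb (bxor x₀ a₂) ^^ hb (bxor x₀ a₀) ^^ hb (bxor (bxor x₀ a₂) a₀)) && (hb x₀ ^^ hb (bxor x₀ a₃) ^^ hb (bxor x₀ a₁) ^^ hb (bxor (bxor x₀ a₃) a₁))) ^^ ((hb x₀ ^^ hb (bxor x₀ a₃) ^^ hb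 (bxor x₀ a₀) ^^ hb (bxor (bxor x₀ a₃) a₀)) && (hb x₀ ^^ hb (bxor x₀ a₂) ^^ hb (bxor x₀ a₁) ^^ hb (bxor (bxor x₀ a₂) a₁))))) = false := by
  classical
  set e : (Fin (6 + 6) → Bool) → ℤ := fun z => u' z - 2 * sZ (f z) with hedef
  have hbe : ∀ z, hb z = decide (e z % 4 = 3) := hhb
  have hPV : ∀ x, Odd (u' x) → ∀ a ∈ V, Odd (u' (bxor x a)) := by
    intro x hx a ha
    have h := fl1_coset_vadd hadd hP (mem_filter.2 ⟨mem_univ _, hx⟩) ha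
    exact (mem_filter.1 h).2
  have ha : ∀ i, (![a₀, a₁, a₂, a₃] : Fin 4 → Fin (6 + 6) → Bool) i ∈ V := by
    intro i; fin_cases i <;> assumption
  have hin : ∀ ε : Fin 4 → Bool, Odd (u' (fun j => x j ^^ decide (Odd #(univ.filter fun i => ε i && (![a₀, a₁, a₂, a₃] : Fin 4 → Fin (6 + 6) → Bool) i j)))) :=
    fun ε => fr_mem_flatPt4 V h0 (fun z => Odd (u' z)) hPV hx _ ha ε
  -- `8 ∣ Σ e₅` over the flat
  have h8 := tzl5_H4 f g hf hg u' hu' V x₀ h0 hadd hcardV hP h4off hoff x hx a₀ a₁ a₂ a₃ ha₀ ha₁ ha₂ ha₃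
  change (8 : ℤ) ∣ ∑ ε : Fin 4 → Bool, e (fun j => x j ^^ decide (Odd #(univ.filter fun i => ε i && (![a₀, a₁, a₂, a₃] : Fin 4 → Fin (6 + 6) → Bool) i j))) at h8
  -- `Σ σ₅ ≡ 4·Pf (mod 8)`
  have hsd := tzl5_hsd f g hf hg u' hu' V x₀ h0 hadd hcardV hP h4off
  have hsd' : ∀ x, Odd (u' x) → ∀ p ∈ V, ∀ q ∈ V, hb (bxor (bxor x p) q) =
      (hb x ^^ hb (bxor x p) ^^ hb (bxor x q) ^^ (hb x₀ ^^ hb (bxor x₀ p) ^^ hb (bxor x₀ q) ^^ hb (bxor (bxor x₀ p) q))) := by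
    intro x hx p hp q hq
    simp only [hbe]
    exact hsd x hx p hp q hq
  have hmod := ws_sum4_mod8 V (fun z => Odd (u' z)) x₀ hb hPV hsd' hx ha₀ ha₁ ha₂ ha₃
  -- pointwise `e₅ = σ₅ + 4k`
  have hk : ∀ ε : Fin 4 → Bool, ∃ k : ℤ, e (fun j => x j ^^ decide (Odd #(univ.filter fun i => ε i && (![a₀, a₁, a₂, a₃] : Fin 4 → Fin (6 + 6) → Bool) i j))) = sZ (hb (fun j => x j ^^ decide (Odd #(univ.filter fun i => ε i && (![a₀, a₁, a₂, a₃] : Fin 4 → Fin (6 + 6) → Bool) i j)))) + 4 * k := by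
    intro ε
    obtain ⟨k, hk⟩ := tzl5_mod4 f u' (hin ε)
    refine ⟨k, ?_⟩
    rw [hbe]
    simp only [e] at hk ⊢
    linarith
  choose k hk using hk
  have hL : ∀ ε : Fin 4 → Bool, (¬ (8 : ℤ) ∣ e (fun j => x j ^^ decide (Odd #(univ.filter fun i => ε i && (![a₀, a₁, a₂, a₃] : Fin 4 → Fin (6 + 6) → Bool) i j))) - sZ (hb (fun j => x j ^^ decide (Odd #(univ.filter fun i => ε i && (![a₀, a₁, a₂, a₃] : Fin 4 → Fin (6 + 6) → Bool) i j))))) ↔ Odd (k ε) := by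
    intro ε
    rw [hk ε, Int.odd_iff]
    constructor
    · intro h; by_contra hne; apply h; exact ⟨k ε / 2, by omega⟩
    · rintro h ⟨j, hj⟩; omega
  have hfilt : (univ.filter fun ε : Fin 4 → Bool => ¬ (8 : ℤ) ∣ e (fun j => x j ^^ decide (Odd #(univ.filter fun i => ε i && (![a₀, a₁, a₂, a₃] : Fin 4 → Fin (6 + 6) → Bool) i j))) - sZ (hb (fun j => x j ^^ decide (Odd #(univ.filter fun i => ε i && (![a₀, a₁, a₂, a₃] : Fin 4 → Fin (6 + 6) → Bool) i j))))) =
      univ.filter fun ε : Fin 4 → Bool => Odd (k ε) := filter_congr fun ε _ => hL ε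
  rw [hfilt, ← tw_even_sum_iff]
  have hsum : ∑ ε : Fin 4 → Bool, e (fun j => x j ^^ decide (Odd #(univ.filter fun i => ε i && (![a₀, a₁, a₂, a₃] : Fin 4 → Fin (6 + 6) → Bool) i j))) = ∑ ε : Fin 4 → Bool, sZ (hb (fun j => x j ^^ decide (Odd #(univ.filter fun i => ε i && (![a₀, a₁, a₂, a₃] : Fin 4 → Fin (6 + 6) → Bool) i j)))) + 4 * ∑ ε : Fin 4 → Bool, k ε := by
    rw [sum_congr rfl fun ε _ => hk ε, sum_add_distrib, mul_sum]
  rw [hsum] at h8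
  obtain ⟨j, hj⟩ := h8
  split_ifs at hmod with hPf
  · rw [hPf]
    constructor
    · rintro ⟨t, ht⟩; exfalso; omega
    · intro h; exact absurd h (by decide)
  · rw [Bool.eq_false_iff.2 hPf]
    constructor
    · intro _; rfl
    · intro _; exact ⟨(∑ ε : Fin 4 → Bool, k ε) / 2, by omega⟩

/-- **Cost of a rigid point**: on the odd hyperplane, `e₅ ≢ σ₅ (mod 8)` forces `|e₅| ≥ 3`, i.e. `e₅² ≥ 9`. [folklore] -/
theorem tzr_cost (f : (Fin (6 + 6) → Bool) → Bool) (u' : (Fin (6 + 6) → Bool) → ℤ)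
    (hb : (Fin (6 + 6) → Bool) → Bool) (hhb : ∀ z, hb z = decide ((u' z - 2 * sZ (f z)) % 4 = 3))
    {x : Fin (6 + 6) → Bool} (hx : Odd (u' x)) (hL : ¬ (8 : ℤ) ∣ u' x - 2 * sZ (f x) - sZ (hb x)) :
    9 ≤ (u' x - 2 * sZ (f x)) ^ 2 := by
  have hodd : Odd (u' x - 2 * sZ (f x)) := Int.odd_sub.2 (iff_of_true hx ⟨sZ (f x), two_mul _⟩)
  rw [hhb] at hL
  have ho := Int.odd_iff.1 hodd
  by_cases h1 : u' x - 2 * sZ (f x) = 1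
  · exfalso; apply hL; rw [h1]; simp [sZ]
  by_cases h2 : u' x - 2 * sZ (f x) = -1
  · exfalso; apply hL; rw [h2]; simp [sZ]
  have : u' x - 2 * sZ (f x) ≤ -3 ∨ 3 ≤ u' x - 2 * sZ (f x) := by omega
  rcases this with h | h <;> nlinarith

/-! ### A Pfaffian frame exists on the window -/

/-- **No frame ⇒ contradiction.**  If `L₅ ≠ ∅`, `Σ_P (e₅² − 1) ≤ 1535` and the Pfaffian vanished on all quadruples of `V`, then `L₅` would have
even parametrised 4-flat sections inside `P` (`tzr_parity`), hence `#L₅ ≥ 2^{11−3} = 256` (generalized Reed–Muller distance on the flat,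
`erm_weight_ge`), costing `8·256 = 2048 > 1535` (`tzr_cost`). [this work] -/
theorem tzr_noframe_false (f g : (Fin (6 + 6) → Bool) → Bool) (hf : IsDegLeFun 3 f) (hg : IsDegLeFun 3 g)
    (u' : (Fin (6 + 6) → Bool) → ℤ) (hu' : ∀ x, W (fun y => signOf (g y)) x = (2 : ℝ) ^ 5 * (u' x : ℝ))
    (V : Finset (Fin (6 + 6) → Bool)) (x₀ : Fin (6 + 6) → Bool) (h0 : zeroVec ∈ V) (hadd : ∀ a ∈ V, ∀ b ∈ V, bxor a b ∈ V)
    (hcardV : #V = 2048) (hP : (univ.filter fun x : Fin (6 + 6) → Bool => Odd (u' x)) = V.image (bxor x₀))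
    (h4off : ∀ y, ¬ Odd (u' y) → (4 : ℤ) ∣ u' y - 2 * sZ (f y))
    (hoff : ∑ y ∈ univ.filter (fun y : Fin (6 + 6) → Bool => ¬ Odd (u' y)), (u' y - 2 * sZ (f y)) ^ 2 ≤ 2047)
    (hb : (Fin (6 + 6) → Bool) → Bool) (hhb : ∀ z, hb z = decide ((u' z - 2 * sZ (f z)) % 4 = 3))
    (hbud : ∑ x ∈ univ.filter (fun x : Fin (6 + 6) → Bool => Odd (u' x)), ((u' x - 2 * sZ (f x)) ^ 2 - 1) ≤ 1535)
    (hL : ∃ x, Odd (u' x) ∧ ¬ (8 : ℤ) ∣ u' x - 2 * sZ (f x) - sZ (hb x))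
    (hno : ∀ a₀ ∈ V, ∀ a₁ ∈ V, ∀ a₂ ∈ V, ∀ a₃ ∈ V, ((((hb x₀ ^^ hb (bxor x₀ a₁) ^^ hb (bxor x₀ a₀) ^^ hb (bxor (bxor x₀ a₁) a₀)) && (hb x₀ ^^ hb (bxor x₀ a₃) ^^ hb (bxor x₀ a₂) ^^ hb (bxor (bxor x₀ a₃) a₂))) ^^ ((hb x₀ ^^ hb (bxor x₀ a₂) ^^ hb (bxor x₀ a₀) ^^ hb (bxor (bxor x₀ a₂) a₀)) && (hb x₀ ^^ hb (bxor x₀ a₃) ^^ hb (bxor x₀ a₁) ^^ hb (bxor (bxor x₀ a₃) a₁))) ^^ ((hb x₀ ^^ hb (bxor x₀ a₃) ^^ hb (bxor x₀ a₀) ^^ hb (bxor (bxor x₀ a₃) a₀)) && (hb x₀ ^^ hb (bxor x₀ a₂) ^^ hb (bxor x₀ a₁) ^^ hb (bxor (bxor x₀ a₂) a₁))))) = false) : False := by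
  classical
  set e : (Fin (6 + 6) → Bool) → ℤ := fun z => u' z - 2 * sZ (f z) with hedef
  set P := univ.filter (fun x : Fin (6 + 6) → Bool => Odd (u' x)) with hPdef
  have hmemP : ∀ x, x ∈ V.image (bxor x₀) ↔ Odd (u' x) := fun x => by rw [← hP]; simp [hPdef]
  have hcardV11 : #V = 2 ^ 11 := by rw [hcardV]; norm_num
  set hd : (Fin (6 + 6) → Bool) → Bool := fun z => decide (¬ (8 : ℤ) ∣ e z - sZ (hb z)) with hddef
  -- even 4-flat sections
  have hflat : ∀ b ∈ V.image (bxor x₀), ∀ a : Fin (3 + 1) → Fin (6 + 6) → Bool, (∀ i, a i ∈ V) →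
      Even #(univ.filter fun ε : Fin (3 + 1) → Bool => hd (fun j => b j ^^ decide (Odd #(univ.filter fun i => ε i && a i j))) = true) := by
    intro b hb' a ha
    have ea : a = ![a 0, a 1, a 2, a 3] := by funext i; fin_cases i <;> rfl
    have hE := (tzr_parity f g hf hg u' hu' V x₀ h0 hadd hcardV hP h4off hoff hb hhb ((hmemP b).1 hb') (ha 0) (ha 1) (ha 2) (ha 3)).2
      (hno _ (ha 0) _ (ha 1) _ (ha 2) _ (ha 3))
    rw [← ea] at hE
    have hf' : (univ.filter fun ε : Fin (3 + 1) → Bool => hd (fun j => b j ^^ decide (Odd #(univ.filter fun i => ε i && a i j))) = true) =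
        univ.filter fun ε : Fin 4 → Bool => ¬ (8 : ℤ) ∣ u' (fun j => b j ^^ decide (Odd #(univ.filter fun i => ε i && a i j))) - 2 * sZ (f (fun j => b j ^^ decide (Odd #(univ.filter fun i => ε i && a i j)))) - sZ (hb (fun j => b j ^^ decide (Odd #(univ.filter fun i => ε i && a i j)))) :=
      filter_congr fun ε _ => by simp [hd, e]
    rw [hf']
    exact hE
  obtain ⟨x, hx, hxL⟩ := hL
  have hex : ∃ z ∈ V.image (bxor x₀), hd z = true := ⟨x, (hmemP x).2 hx, by simp [hd, e]; exact hxL⟩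
  have hge := erm_weight_ge 11 3 V h0 (fun a ha b hb' => hadd a ha b hb') hcardV11 x₀ hd hflat hex
  -- `#L₅ ≥ 256`
  set L := (V.image (bxor x₀)).filter (fun z => hd z = true) with hLdef
  have hL256 : 256 ≤ #L := by norm_num at hge; omega
  have hLsub : L ⊆ P := by
    intro z hz
    exact mem_filter.2 ⟨mem_univ _, (hmemP z).1 (mem_filter.1 hz).1⟩
  have hLcost : ∀ z ∈ L, (8 : ℤ) ≤ e z ^ 2 - 1 := by
    intro z hz
    obtain ⟨hz1, hz2⟩ := mem_filter.1 hz
    have hzL : ¬ (8 : ℤ) ∣ u' z - 2 * sZ (f z) - sZ (hb z) := by simpa [hd, e] using hz2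
    have h9 := tzr_cost f u' hb hhb ((hmemP z).1 hz1) hzL
    simp only [e]; linarith
  have hPnn : ∀ z ∈ P, (0 : ℤ) ≤ e z ^ 2 - 1 := by
    intro z hz
    have hodd : Odd (e z) := Int.odd_sub.2 (iff_of_true (mem_filter.1 hz).2 ⟨sZ (f z), two_mul _⟩)
    have ho := Int.odd_iff.1 hodd
    have : e z ≤ -1 ∨ 1 ≤ e z := by omega
    rcases this with h | h <;> nlinarith
  have : (2048 : ℤ) ≤ ∑ z ∈ P, (e z ^ 2 - 1) :=
    calc (2048 : ℤ) ≤ 8 * #L := by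
          have : (256 : ℤ) ≤ #L := by exact_mod_cast hL256
          linarith
      _ = ∑ z ∈ L, (8 : ℤ) := by rw [sum_const, nsmul_eq_mul, mul_comm]
      _ ≤ ∑ z ∈ L, (e z ^ 2 - 1) := sum_le_sum hLcost
      _ ≤ ∑ z ∈ P, (e z ^ 2 - 1) := sum_le_sum_of_subset_of_nonneg hLsub fun z hz _ => hPnn z hz
  have hbud' : ∑ z ∈ P, (e z ^ 2 - 1) ≤ 1535 := hbud
  linarith

/-- **A Pfaffian frame exists** in the rigid case on the window budget: some `a₀,…,a₃ ∈ V` have `Pf(a) = 1`. [this work] -/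
theorem tzr_frame (f g : (Fin (6 + 6) → Bool) → Bool) (hf : IsDegLeFun 3 f) (hg : IsDegLeFun 3 g)
    (u' : (Fin (6 + 6) → Bool) → ℤ) (hu' : ∀ x, W (fun y => signOf (g y)) x = (2 : ℝ) ^ 5 * (u' x : ℝ))
    (V : Finset (Fin (6 + 6) → Bool)) (x₀ : Fin (6 + 6) → Bool) (h0 : zeroVec ∈ V) (hadd : ∀ a ∈ V, ∀ b ∈ V, bxor a b ∈ V)
    (hcardV : #V = 2048) (hP : (univ.filter fun x : Fin (6 + 6) → Bool => Odd (u' x)) = V.image (bxor x₀))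
    (h4off : ∀ y, ¬ Odd (u' y) → (4 : ℤ) ∣ u' y - 2 * sZ (f y))
    (hoff : ∑ y ∈ univ.filter (fun y : Fin (6 + 6) → Bool => ¬ Odd (u' y)), (u' y - 2 * sZ (f y)) ^ 2 ≤ 2047)
    (hb : (Fin (6 + 6) → Bool) → Bool) (hhb : ∀ z, hb z = decide ((u' z - 2 * sZ (f z)) % 4 = 3))
    (hbud : ∑ x ∈ univ.filter (fun x : Fin (6 + 6) → Bool => Odd (u' x)), ((u' x - 2 * sZ (f x)) ^ 2 - 1) ≤ 1535)
    (hL : ∃ x, Odd (u' x) ∧ ¬ (8 : ℤ) ∣ u' x - 2 * sZ (f x) - sZ (hb x)) :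
    ∃ a₀ ∈ V, ∃ a₁ ∈ V, ∃ a₂ ∈ V, ∃ a₃ ∈ V, ((((hb x₀ ^^ hb (bxor x₀ a₁) ^^ hb (bxor x₀ a₀) ^^ hb (bxor (bxor x₀ a₁) a₀)) && (hb x₀ ^^ hb (bxor x₀ a₃) ^^ hb (bxor x₀ a₂) ^^ hb (bxor (bxor x₀ a₃) a₂))) ^^ ((hb x₀ ^^ hb (bxor x₀ a₂) ^^ hb (bxor x₀ a₀) ^^ hb (bxor (bxor x₀ a₂) a₀)) && (hb x₀ ^^ hb (bxor x₀ a₃) ^^ hb (bxor x₀ a₁) ^^ hb (bxor (bxor x₀ a₃) a₁))) ^^ ((hb x₀ ^^ hb (bxor x₀ a₃) ^^ hb (bxor x₀ a₀) ^^ hb (bxor (bxor x₀ a₃) a₀)) && (hb x₀ ^^ hb (bxor x₀ a₂) ^^ hb (bxor x₀ a₁) ^^ hb (bxor (bxor x₀ a₂) a₁))))) = true := by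
  by_contra hno
  push Not at hno
  exact tzr_noframe_false f g hf hg u' hu' V x₀ h0 hadd hcardV hP h4off hoff hb hhb hbud hL
    fun a₀ ha₀ a₁ ha₁ a₂ ha₂ a₃ ha₃ => Bool.eq_false_iff.2 (hno a₀ ha₀ a₁ ha₁ a₂ ha₂ a₃ ha₃)

/-! ### Counting with a Pfaffian frame: `#L₅ ≥ 128` -/

/-- **Odd sections.**  For a frame `a₀,…,a₃ ∈ V` with `Pf = 1`, every parametrised 4-flat `x ⊕ ⟨a⟩` (`x ∈ P`) meets `L₅` in an odd number of
parameters. [this work] -/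
theorem tzr_sections_odd (f g : (Fin (6 + 6) → Bool) → Bool) (hf : IsDegLeFun 3 f) (hg : IsDegLeFun 3 g)
    (u' : (Fin (6 + 6) → Bool) → ℤ) (hu' : ∀ x, W (fun y => signOf (g y)) x = (2 : ℝ) ^ 5 * (u' x : ℝ))
    (V : Finset (Fin (6 + 6) → Bool)) (x₀ : Fin (6 + 6) → Bool) (h0 : zeroVec ∈ V) (hadd : ∀ a ∈ V, ∀ b ∈ V, bxor a b ∈ V)
    (hcardV : #V = 2048) (hP : (univ.filter fun x : Fin (6 + 6) → Bool => Odd (u' x)) = V.image (bxor x₀))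
    (h4off : ∀ y, ¬ Odd (u' y) → (4 : ℤ) ∣ u' y - 2 * sZ (f y))
    (hoff : ∑ y ∈ univ.filter (fun y : Fin (6 + 6) → Bool => ¬ Odd (u' y)), (u' y - 2 * sZ (f y)) ^ 2 ≤ 2047)
    (hb : (Fin (6 + 6) → Bool) → Bool) (hhb : ∀ z, hb z = decide ((u' z - 2 * sZ (f z)) % 4 = 3))
    {a₀ a₁ a₂ a₃ : Fin (6 + 6) → Bool} (ha₀ : a₀ ∈ V) (ha₁ : a₁ ∈ V) (ha₂ : a₂ ∈ V) (ha₃ : a₃ ∈ V)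
    (hPf : ((((hb x₀ ^^ hb (bxor x₀ a₁) ^^ hb (bxor x₀ a₀) ^^ hb (bxor (bxor x₀ a₁) a₀)) && (hb x₀ ^^ hb (bxor x₀ a₃) ^^ hb (bxor x₀ a₂) ^^ hb (bxor (bxor x₀ a₃) a₂))) ^^ ((hb x₀ ^^ hb (bxor x₀ a₂) ^^ hb (bxor x₀ a₀) ^^ hb (bxor (bxor x₀ a₂) a₀)) && (hb x₀ ^^ hb (bxor x₀ a₃) ^^ hb (bxor x₀ a₁) ^^ hb (bxor (bxor x₀ a₃) a₁))) ^^ ((hb x₀ ^^ hb (bxor x₀ a₃) ^^ hb (bxor x₀ a₀) ^^ hb (bxor (bxor x₀ a₃) a₀)) && (hb x₀ ^^ hb (bxor x₀ a₂) ^^ hb (bxor x₀ a₁) ^^ hb (bxor (bxor x₀ a₂) a₁))))) = true) (x : Fin (6 + 6) → Bool) (hx : Odd (u' x)) :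
    Odd #(univ.filter fun ε : Fin 4 → Bool =>
      ¬ (8 : ℤ) ∣ u' (fun j => x j ^^ decide (Odd #(univ.filter fun i => ε i && (![a₀, a₁, a₂, a₃] : Fin 4 → Fin (6 + 6) → Bool) i j))) - 2 * sZ (f (fun j => x j ^^ decide (Odd #(univ.filter fun i => ε i && (![a₀, a₁, a₂, a₃] : Fin 4 → Fin (6 + 6) → Bool) i j)))) - sZ (hb (fun j => x j ^^ decide (Odd #(univ.filter fun i => ε i && (![a₀, a₁, a₂, a₃] : Fin 4 → Fin (6 + 6) → Bool) i j))))) := by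
  have h := tzr_parity f g hf hg u' hu' V x₀ h0 hadd hcardV hP h4off hoff hb hhb hx ha₀ ha₁ ha₂ ha₃
  rw [hPf] at h
  exact Nat.not_even_iff_odd.1 fun hE => absurd (h.1 hE) (by decide)

/-- **`#L₅ ≥ 128` from a Pfaffian frame**: the odd section counts `N(x;a) ≥ 1` (`x ∈ P`) add up, by double counting (`x ↦ x ⊕ ε·a` permutes
`P`, `ws_card_translate`), to `16·#L₅ ≥ #P = 2048`. [this work] -/
theorem tzr_L5_card_ge (f g : (Fin (6 + 6) → Bool) → Bool) (hf : IsDegLeFun 3 f) (hg : IsDegLeFun 3 g)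
    (u' : (Fin (6 + 6) → Bool) → ℤ) (hu' : ∀ x, W (fun y => signOf (g y)) x = (2 : ℝ) ^ 5 * (u' x : ℝ))
    (V : Finset (Fin (6 + 6) → Bool)) (x₀ : Fin (6 + 6) → Bool) (h0 : zeroVec ∈ V) (hadd : ∀ a ∈ V, ∀ b ∈ V, bxor a b ∈ V)
    (hcardV : #V = 2048) (hP : (univ.filter fun x : Fin (6 + 6) → Bool => Odd (u' x)) = V.image (bxor x₀))
    (h4off : ∀ y, ¬ Odd (u' y) → (4 : ℤ) ∣ u' y - 2 * sZ (f y))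
    (hoff : ∑ y ∈ univ.filter (fun y : Fin (6 + 6) → Bool => ¬ Odd (u' y)), (u' y - 2 * sZ (f y)) ^ 2 ≤ 2047)
    (hb : (Fin (6 + 6) → Bool) → Bool) (hhb : ∀ z, hb z = decide ((u' z - 2 * sZ (f z)) % 4 = 3))
    {a₀ a₁ a₂ a₃ : Fin (6 + 6) → Bool} (ha₀ : a₀ ∈ V) (ha₁ : a₁ ∈ V) (ha₂ : a₂ ∈ V) (ha₃ : a₃ ∈ V)
    (hPf : ((((hb x₀ ^^ hb (bxor x₀ a₁) ^^ hb (bxor x₀ a₀) ^^ hb (bxor (bxor x₀ a₁) a₀)) && (hb x₀ ^^ hb (bxor x₀ a₃) ^^ hb (bxor x₀ a₂) ^^ hb (bxor (bxor x₀ a₃) a₂))) ^^ ((hb x₀ ^^ hb (bxor x₀ a₂) ^^ hb (bxor x₀ a₀) ^^ hb (bxor (bxor x₀ a₂) a₀)) && (hb x₀ ^^ hb (bxor x₀ a₃) ^^ hb (bxor x₀ a₁) ^^ hb (bxor (bxor x₀ a₃) a₁))) ^^ ((hb x₀ ^^ hb (bxor x₀ a₃) ^^ hb (bxor x₀ a₀)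 ^^ hb (bxor (bxor x₀ a₃) a₀)) && (hb x₀ ^^ hb (bxor x₀ a₂) ^^ hb (bxor x₀ a₁) ^^ hb (bxor (bxor x₀ a₂) a₁))))) = true) :
    128 ≤ #(univ.filter fun z : Fin (6 + 6) → Bool => Odd (u' z) ∧ ¬ (8 : ℤ) ∣ u' z - 2 * sZ (f z) - sZ (hb z)) := by
  classical
  set e : (Fin (6 + 6) → Bool) → ℤ := fun z => u' z - 2 * sZ (f z) with hedef
  set Pset := univ.filter (fun z : Fin (6 + 6) → Bool => Odd (u' z)) with hPset
  have ha : ∀ i, (![a₀, a₁, a₂, a₃] : Fin 4 → Fin (6 + 6) → Bool) i ∈ V := by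
    intro i; fin_cases i <;> assumption
  have hinj : Function.Injective (bxor x₀) := fun a b h => by
    have := congrArg (bxor x₀) h; rwa [bxor_bxor_cancel_left, bxor_bxor_cancel_left] at this
  have hPcard : #Pset = 2048 := by rw [hP, card_image_of_injective _ hinj, hcardV]
  have hodd : ∀ z ∈ Pset, Odd #(univ.filter fun ε : Fin 4 → Bool => ¬ (8 : ℤ) ∣ e (fun j => z j ^^ decide (Odd #(univ.filter fun i => ε i && (![a₀, a₁, a₂, a₃] : Fin 4 → Fin (6 + 6) → Bool) i j))) - sZ (hb (fun j => z j ^^ decide (Odd #(univ.filter fun i => ε i && (![a₀, a₁, a₂, a₃] : Fin 4 → Fin (6 + 6) → Bool) i j))))) := by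
    intro z hz
    have hz' : Odd (u' z) := by simpa [Pset] using hz
    exact tzr_sections_odd f g hf hg u' hu' V x₀ h0 hadd hcardV hP h4off hoff hb hhb ha₀ ha₁ ha₂ ha₃ hPf z hz'
  -- the flat points of the origin are periods
  have hc : ∀ ε : Fin 4 → Bool, (fun j => zeroVec j ^^ decide (Odd #(univ.filter fun i => ε i && (![a₀, a₁, a₂, a₃] : Fin 4 → Fin (6 + 6) → Bool) i j))) ∈ V :=
    fun ε => ws_flatPt_mem V h0 (fun z => z ∈ V) (fun z hz b hb' => hadd z hz b hb') 4 zeroVec h0 _ ha ε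
  -- double counting
  set T := univ.filter (fun z : Fin (6 + 6) → Bool => Odd (u' z) ∧ ¬ (8 : ℤ) ∣ e z - sZ (hb z)) with hTdef
  have hTP : (Pset.filter fun z => ¬ (8 : ℤ) ∣ e z - sZ (hb z)) = T := by
    simp only [Pset, T, filter_filter]
  have hsum : ∑ z ∈ Pset, #(univ.filter fun ε : Fin 4 → Bool => ¬ (8 : ℤ) ∣ e (fun j => z j ^^ decide (Odd #(univ.filter fun i => ε i && (![a₀, a₁, a₂, a₃] : Fin 4 → Fin (6 + 6) → Bool) i j))) - sZ (hb (fun j => z j ^^ decide (Odd #(univ.filter fun i => ε i && (![a₀, a₁, a₂, a₃] : Fin 4 → Fin (6 + 6) → Bool) i j))))) = ∑ ε : Fin 4 → Bool, #T := by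
    calc ∑ z ∈ Pset, #(univ.filter fun ε : Fin 4 → Bool => ¬ (8 : ℤ) ∣ e (fun j => z j ^^ decide (Odd #(univ.filter fun i => ε i && (![a₀, a₁, a₂, a₃] : Fin 4 → Fin (6 + 6) → Bool) i j))) - sZ (hb (fun j => z j ^^ decide (Odd #(univ.filter fun i => ε i && (![a₀, a₁, a₂, a₃] : Fin 4 → Fin (6 + 6) → Bool) i j)))))
        = ∑ z ∈ Pset, ∑ ε : Fin 4 → Bool, (if ¬ (8 : ℤ) ∣ e (fun j => z j ^^ decide (Odd #(univ.filter fun i => ε i && (![a₀, a₁, a₂, a₃] : Fin 4 → Fin (6 + 6) → Bool) i j))) - sZ (hb (fun j => z j ^^ decide (Odd #(univ.filter fun i => ε i && (![a₀, a₁, a₂, a₃] : Fin 4 → Fin (6 + 6) → Bool) i j)))) then 1 else 0) :=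
          sum_congr rfl fun z _ => by rw [sum_boole, Nat.cast_id]
      _ = ∑ ε : Fin 4 → Bool, ∑ z ∈ Pset, (if ¬ (8 : ℤ) ∣ e (fun j => z j ^^ decide (Odd #(univ.filter fun i => ε i && (![a₀, a₁, a₂, a₃] : Fin 4 → Fin (6 + 6) → Bool) i j))) - sZ (hb (fun j => z j ^^ decide (Odd #(univ.filter fun i => ε i && (![a₀, a₁, a₂, a₃] : Fin 4 → Fin (6 + 6) → Bool) i j)))) then 1 else 0) := sum_comm
      _ = ∑ ε : Fin 4 → Bool, #(Pset.filter fun z => ¬ (8 : ℤ) ∣ e (bxor z (fun j => zeroVec j ^^ decide (Odd #(univ.filter fun i => ε i && (![a₀, a₁, a₂, a₃] : Fin 4 → Fin (6 + 6) → Bool) i j)))) - sZ (hb (bxor z (fun j => zeroVec j ^^ decide (Odd #(univ.filter fun i => ε i && (![a₀, a₁, a₂, a₃] : Fin 4 → Fin (6 + 6) → Bool) i j)))))) := by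
          refine sum_congr rfl fun ε _ => ?_
          rw [sum_boole, Nat.cast_id]
          exact congrArg card (filter_congr fun z _ => by rw [ws_flatPt_eq_bxor z _ ε])
      _ = ∑ ε : Fin 4 → Bool, #(Pset.filter fun z => ¬ (8 : ℤ) ∣ e z - sZ (hb z)) :=
          sum_congr rfl fun ε _ => ws_card_translate V Pset x₀ hadd hP (hc ε) (fun z => ¬ (8 : ℤ) ∣ e z - sZ (hb z))
      _ = ∑ ε : Fin 4 → Bool, #T := by rw [hTP]
  have hle : ∀ z ∈ Pset, 1 ≤ #(univ.filter fun ε : Fin 4 → Bool => ¬ (8 : ℤ) ∣ e (fun j => z j ^^ decide (Odd #(univ.filter fun i => ε i && (![a₀, a₁, a₂, a₃] : Fin 4 → Fin (6 + 6) → Bool) i j))) - sZ (hb (fun j => z j ^^ decide (Odd #(univ.filter fun i => ε i && (![a₀, a₁, a₂, a₃] : Fin 4 → Fin (6 + 6) → Bool) i j))))) := by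
    intro z hz
    rcases hodd z hz with ⟨r, hr⟩
    omega
  have h1 : ∑ z ∈ Pset, 1 ≤ ∑ z ∈ Pset, #(univ.filter fun ε : Fin 4 → Bool => ¬ (8 : ℤ) ∣ e (fun j => z j ^^ decide (Odd #(univ.filter fun i => ε i && (![a₀, a₁, a₂, a₃] : Fin 4 → Fin (6 + 6) → Bool) i j))) - sZ (hb (fun j => z j ^^ decide (Odd #(univ.filter fun i => ε i && (![a₀, a₁, a₂, a₃] : Fin 4 → Fin (6 + 6) → Bool) i j))))) := sum_le_sum hle
  rw [hsum, sum_const, smul_eq_mul, mul_one, hPcard, sum_const, smul_eq_mul, card_univ, Fintype.card_fun, Fintype.card_bool,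
    Fintype.card_fin] at h1
  show 128 ≤ #T
  norm_num at h1
  omega

/-! ### Packaging on the open window -/

/-- **The rigid case with `4 ∣ e₅` off the hyperplane, on the open window (packaging).**  Cubic `f, g` on 12 bits, `W_g = 32u'` with some `u'`
odd, `57/64 < Φ(f,g)`, `4 ∣ e₅` off the odd set (not case α) and some point of the odd set with `e₅ ≢ σ₅ (mod 8)`.  Then the odd set is a hyperplane
`x₀ ⊕ V` (`#V = 2048`); some frame `a₀,…,a₃ ∈ V` has Pfaffian `1` and all its section counts through `L₅` odd; `128 ≤ #L₅ ≤ 191`; the hyperplane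
excess `Σ_P (e₅² − 1)` is `≥ 1024`, the off-hyperplane energy is `≤ 511`, and their sum is `≤ 1535`.  Finite-slice statement, NOT summit progress.
[this work] -/
theorem tzr_window_rigid (f g : (Fin (6 + 6) → Bool) → Bool) (hf : IsDegLeFun 3 f) (hg : IsDegLeFun 3 g)
    (u' : (Fin (6 + 6) → Bool) → ℤ) (hu' : ∀ x, W (fun y => signOf (g y)) x = (2 : ℝ) ^ 5 * (u' x : ℝ)) (hodd : ∃ x, Odd (u' x))
    (hlo : (57 / 64 : ℝ) < forrelation f g)
    (h4off : ∀ y, ¬ Odd (u' y) → (4 : ℤ) ∣ u' y - 2 * sZ (f y))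
    (hb : (Fin (6 + 6) → Bool) → Bool) (hhb : ∀ z, hb z = decide ((u' z - 2 * sZ (f z)) % 4 = 3))
    (hL : ∃ x, Odd (u' x) ∧ ¬ (8 : ℤ) ∣ u' x - 2 * sZ (f x) - sZ (hb x)) :
    ∃ (V : Finset (Fin (6 + 6) → Bool)) (x₀ : Fin (6 + 6) → Bool),
      zeroVec ∈ V ∧ (∀ a ∈ V, ∀ b ∈ V, bxor a b ∈ V) ∧ #V = 2048 ∧
      (univ.filter fun x : Fin (6 + 6) → Bool => Odd (u' x)) = V.image (bxor x₀) ∧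
      (∃ a₀ ∈ V, ∃ a₁ ∈ V, ∃ a₂ ∈ V, ∃ a₃ ∈ V, ((((hb x₀ ^^ hb (bxor x₀ a₁) ^^ hb (bxor x₀ a₀) ^^ hb (bxor (bxor x₀ a₁) a₀)) && (hb x₀ ^^ hb (bxor x₀ a₃) ^^ hb (bxor x₀ a₂) ^^ hb (bxor (bxor x₀ a₃) a₂))) ^^ ((hb x₀ ^^ hb (bxor x₀ a₂) ^^ hb (bxor x₀ a₀) ^^ hb (bxor (bxor x₀ a₂) a₀)) && (hb x₀ ^^ hb (bxor x₀ a₃) ^^ hb (bxor x₀ a₁) ^^ hb (bxor (bxor x₀ a₃) a₁))) ^^ ((hb x₀ ^^ hb (bxor x₀ a₃) ^^ hb (bxor x₀ a₀) ^^ hb (bxor (bxor x₀ a₃) a₀)) && (hb x₀ ^^ hb (bxor x₀ a₂) ^^ hb (bxor x₀ a₁) ^^ hb (bxor (bxor x₀ a₂) a₁))))) = true ∧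
        ∀ x, Odd (u' x) → Odd #(univ.filter fun ε : Fin 4 → Bool =>
          ¬ (8 : ℤ) ∣ u' (fun j => x j ^^ decide (Odd #(univ.filter fun i => ε i && (![a₀, a₁, a₂, a₃] : Fin 4 → Fin (6 + 6) → Bool) i j))) - 2 * sZ (f (fun j => x j ^^ decide (Odd #(univ.filter fun i => ε i && (![a₀, a₁, a₂, a₃] : Fin 4 → Fin (6 + 6) → Bool) i j)))) - sZ (hb (fun j => x j ^^ decide (Odd #(univ.filter fun i => ε i && (![a₀, a₁, a₂, a₃] : Fin 4 → Fin (6 + 6) → Bool) i j)))))) ∧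
      128 ≤ #(univ.filter fun z : Fin (6 + 6) → Bool => Odd (u' z) ∧ ¬ (8 : ℤ) ∣ u' z - 2 * sZ (f z) - sZ (hb z)) ∧
      #(univ.filter fun z : Fin (6 + 6) → Bool => Odd (u' z) ∧ ¬ (8 : ℤ) ∣ u' z - 2 * sZ (f z) - sZ (hb z)) ≤ 191 ∧
      1024 ≤ ∑ x ∈ univ.filter (fun x : Fin (6 + 6) → Bool => Odd (u' x)), ((u' x - 2 * sZ (f x)) ^ 2 - 1) ∧
      ∑ y ∈ univ.filter (fun y : Fin (6 + 6) → Bool => ¬ Odd (u' y)), (u' y - 2 * sZ (f y)) ^ 2 ≤ 511 ∧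
      ∑ x ∈ univ.filter (fun x : Fin (6 + 6) → Bool => Odd (u' x)), ((u' x - 2 * sZ (f x)) ^ 2 - 1) +
        ∑ y ∈ univ.filter (fun y : Fin (6 + 6) → Bool => ¬ Odd (u' y)), (u' y - 2 * sZ (f y)) ^ 2 ≤ 1535 := by
  classical
  set P := univ.filter (fun x : Fin (6 + 6) → Bool => Odd (u' x)) with hPdef
  set P' := univ.filter (fun x : Fin (6 + 6) → Bool => ¬ Odd (u' x)) with hP'def
  set e : (Fin (6 + 6) → Bool) → ℤ := fun x => u' x - 2 * sZ (f x) with hedef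
  -- budget `Σ e² = 32768(1 − Φ) < 3584`
  set u : (Fin (6 + 6) → Bool) → ℤ := fun x => 2 * u' x with hudef
  have hu : ∀ x, W (fun y => signOf (g y)) x = (2 : ℝ) ^ 4 * (u x : ℝ) := by
    intro x; rw [hu' x]; simp only [u]; push_cast; ring
  have hbudR := tw12_budget f g u hu
  have h4e : ∀ x, (u x - 4 * sZ (f x)) ^ 2 = 4 * e x ^ 2 := fun x => by simp only [u, e]; ring
  have hBR : ((∑ x, e x ^ 2 : ℤ) : ℝ) = 32768 * (1 - forrelation f g) := by
    have h' : ((∑ x, (u x - 4 * sZ (f x)) ^ 2 : ℤ) : ℝ) = 4 * ((∑ x, e x ^ 2 : ℤ) : ℝ) := by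
      rw [sum_congr rfl fun x _ => h4e x, ← mul_sum]; push_cast; ring
    rw [h'] at hbudR
    linarith
  have hB : (∑ x, e x ^ 2 : ℤ) ≤ 3583 := by
    have h' : ((∑ x, e x ^ 2 : ℤ) : ℝ) < 3584 := by rw [hBR]; linarith
    have h'' : (∑ x, e x ^ 2 : ℤ) < 3584 := by exact_mod_cast h'
    omega
  -- the hyperplane
  obtain ⟨x, hx, hxL⟩ := hL
  have heodd : ∀ z, Odd (u' z) → Odd (e z) := fun z hz => Int.odd_sub.2 (iff_of_true hz ⟨sZ (f z), two_mul _⟩)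
  have hsq1 : ∀ z, Odd (u' z) → (1 : ℤ) ≤ e z ^ 2 := fun z hz => by
    have h0 := Int.odd_iff.1 (heodd z hz)
    have : e z ≤ -1 ∨ 1 ≤ e z := by omega
    rcases this with h | h <;> nlinarith
  have hev : ∃ y, ¬ Odd (u' y) := by
    by_contra hall
    push Not at hall
    have hge : ∀ z, (1 : ℤ) ≤ e z ^ 2 := fun z => hsq1 z (hall z)
    have h9 : (9 : ℤ) ≤ e x ^ 2 := tzr_cost f u' hb hhb hx hxL
    have hsum : (∑ z, e z ^ 2 : ℤ) = ∑ z ∈ univ.erase x, e z ^ 2 + e x ^ 2 := (sum_erase_add _ _ (mem_univ x)).symm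
    have hrest : (4095 : ℤ) ≤ ∑ z ∈ univ.erase x, e z ^ 2 :=
      calc (4095 : ℤ) = ∑ z ∈ (univ : Finset (Fin (6 + 6) → Bool)).erase x, (1 : ℤ) := by
            rw [sum_const, nsmul_eq_mul, mul_one, card_erase_of_mem (mem_univ x), card_univ, Fintype.card_fun, Fintype.card_bool,
              Fintype.card_fin]; norm_num
        _ ≤ ∑ z ∈ univ.erase x, e z ^ 2 := sum_le_sum fun z _ => hge z
    linarith
  obtain ⟨V, x₀, h0, hadd, hcardV, hP⟩ := tzl5_hyperplane g hg u' hu' hodd hev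
  -- split of the budget
  have hsplit : (∑ z, e z ^ 2 : ℤ) = ∑ z ∈ P, e z ^ 2 + ∑ y ∈ P', e y ^ 2 :=
    (sum_filter_add_sum_filter_not (s := (univ : Finset (Fin (6 + 6) → Bool))) (p := fun z => Odd (u' z)) (f := fun z => e z ^ 2)).symm
  have hinj : Function.Injective (bxor x₀) := fun a b h => by
    have := congrArg (bxor x₀) h; rwa [bxor_bxor_cancel_left, bxor_bxor_cancel_left] at this
  have hcardP : #P = 2048 := by rw [hPdef, hP, card_image_of_injective _ hinj, hcardV]
  have hPsum : ∑ z ∈ P, (e z ^ 2 - 1) = ∑ z ∈ P, e z ^ 2 - 2048 := by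
    rw [sum_sub_distrib, sum_const, nsmul_eq_mul, mul_one, hcardP]; norm_num
  have hP'nn : (0 : ℤ) ≤ ∑ y ∈ P', e y ^ 2 := sum_nonneg fun _ _ => sq_nonneg _
  have htot : ∑ z ∈ P, (e z ^ 2 - 1) + ∑ y ∈ P', e y ^ 2 ≤ 1535 := by rw [hPsum]; linarith
  have hbud : ∑ z ∈ P, (e z ^ 2 - 1) ≤ 1535 := by linarith
  have hoff : ∑ y ∈ P', e y ^ 2 ≤ 2047 := by
    have hPnn : (0 : ℤ) ≤ ∑ z ∈ P, (e z ^ 2 - 1) :=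
      sum_nonneg fun z hz => by have := hsq1 z (mem_filter.1 hz).2; linarith
    linarith
  -- the frame and the count
  obtain ⟨a₀, ha₀, a₁, ha₁, a₂, ha₂, a₃, ha₃, hPf⟩ :=
    tzr_frame f g hf hg u' hu' V x₀ h0 hadd hcardV hP h4off hoff hb hhb hbud ⟨x, hx, hxL⟩
  have h128 := tzr_L5_card_ge f g hf hg u' hu' V x₀ h0 hadd hcardV hP h4off hoff hb hhb ha₀ ha₁ ha₂ ha₃ hPf
  -- cost of `L₅`
  set T := univ.filter (fun z : Fin (6 + 6) → Bool => Odd (u' z) ∧ ¬ (8 : ℤ) ∣ e z - sZ (hb z)) with hTdef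
  have hTsub : T ⊆ P := fun z hz => mem_filter.2 ⟨mem_univ _, (mem_filter.1 hz).2.1⟩
  have hTcost : ∀ z ∈ T, (8 : ℤ) ≤ e z ^ 2 - 1 := by
    intro z hz
    obtain ⟨-, hz1, hz2⟩ := mem_filter.1 hz
    have h9 := tzr_cost f u' hb hhb hz1 hz2
    simp only [e]; linarith
  have hPnn' : ∀ z ∈ P, (0 : ℤ) ≤ e z ^ 2 - 1 := fun z hz => by
    have := hsq1 z (mem_filter.1 hz).2; linarith
  have hTle : 8 * (#T : ℤ) ≤ ∑ z ∈ P, (e z ^ 2 - 1) :=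
    calc 8 * (#T : ℤ) = ∑ z ∈ T, (8 : ℤ) := by rw [sum_const, nsmul_eq_mul, mul_comm]
      _ ≤ ∑ z ∈ T, (e z ^ 2 - 1) := sum_le_sum hTcost
      _ ≤ ∑ z ∈ P, (e z ^ 2 - 1) := sum_le_sum_of_subset_of_nonneg hTsub fun z hz _ => hPnn' z hz
  have h128' : (128 : ℤ) ≤ #T := by exact_mod_cast h128
  refine ⟨V, x₀, h0, hadd, hcardV, hP, ⟨a₀, ha₀, a₁, ha₁, a₂, ha₂, a₃, ha₃, hPf, fun z hz =>
    tzr_sections_odd f g hf hg u' hu' V x₀ h0 hadd hcardV hP h4off hoff hb hhb ha₀ ha₁ ha₂ ha₃ hPf z hz⟩, h128, ?_, ?_, ?_, htot⟩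
  · have : (#T : ℤ) ≤ 191 := by
      have : 8 * (#T : ℤ) ≤ 1535 := le_trans hTle hbud
      linarith
    exact_mod_cast this
  · linarith
  · linarith

end Summit.QuantumAdvantage.QuantumAdvantage.Theorems.CubicForrelation.NearExactIsExact

end
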